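import Literature.Geometry.Lorentzian.LinearConstraintMoments
import Mathlib.Analysis.Convex.Star
import Mathlib.Data.List.GetD
import Literature.Geometry.DiscreteGeometry.LayerShells
import HarnessLib

/-!
# Covering the annulus `A₁` by finitely many sets star-shaped with respect to balls

(trunk G08 = T-LORENTZ; family `gr`; namespace `Literature.Geometry.Lorentzian.MaoOhTao`.)

Mao–Oh–Tao (arXiv:2308.13031), proof of Lemma 2.2 (p. 9): "By Lemma 2.3, such an operator exists for domains that are
star-shaped with respect to a ball. […] by a simple recursion argument, this observation would allow us to define a
Bogovskii-type operator on any finite union of such sets, such as `A₁`."  The geometric input — that the annulus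
`A₁ = {1 < |x| < 2}` is a finite union of open sets, each star-shaped with respect to every point of a ball, which can
be ordered so that each meets the union of the previous ones — is implicit there; this file supplies it:

* `annSector ω = {1 < |x| < 2, (18/25)|x||ω| < x·ω}` — the annular sector of aperture `arccos(18/25) ≈ 44°` about
  the direction `ω`; it is open (`isOpen_annSector`) and star-shaped with respect to every point of the ball of
  radius `1/20` about `(3/2) ω/|ω|` (`starConvex_annSector`: along a segment towards `b` the quantity `y·x̂` stays
  `> 1`, `|y| ≤ a|b| + t|x| < 2`, and the cone `{(18/25)|y| < y·ω̂}` is convex);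
* `exists_mem_annSector` — the fourteen sectors about `±eᵢ` and `(±1, ±1, ±1)` cover `A₁` (if `Σ|xᵢ| ≤ (18/25)√3|x|`
  then some `|xᵢ| > (18/25)|x|`, since otherwise `|x|² ≤ (18/25)²√3|x|² < |x|²`);
* `dirSeq` — an enumeration of the fourteen directions in which each sector meets an earlier one, with explicit
  common points (`dirSeq_chain`), and `biUnion_annSector_dirSeq_eq` — their union is `A₁`.

Everything is proved; the definitions are the sector, the sign/corner/axis/witness vectors and the enumeration.

## References

* Y. Mao, S.-J. Oh, T. Tao, arXiv:2308.13031 (2023), proof of Lemma 2.2, p. 9 (key `MaoOhTao2023`).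
-/

noncomputable section

open scoped RealInnerProductSpace
open Set Metric Function

namespace Literature.Geometry.Lorentzian

namespace MaoOhTao

/-! ### Coordinates on `E3`

`inner_fin3` and `norm_sq_fin3` (`x·y` and `|x|²` in coordinates) are reused from
`Literature.Geometry.DiscreteGeometry.LayerShells`. -/

open Literature.Geometry.DiscreteGeometry (inner_fin3 norm_sq_fin3)

/-! ### Annular sectors -/

/-- **The annular sector** about the direction `ω`: `{1 < |x| < 2, (18/25)|x||ω| < x·ω}` (aperture
`arccos(18/25)`). [cite: MaoOhTao2023, Lemma 2.2 (proof)] -/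
def annSector (ω : E3) : Set E3 :=
  {x | 1 < ‖x‖ ∧ ‖x‖ < 2 ∧ (18 / 25 : ℝ) * (‖x‖ * ‖ω‖) < ⟪x, ω⟫}

/-- Membership in the annular sector. [folklore] -/
theorem mem_annSector {ω x : E3} :
    x ∈ annSector ω ↔ 1 < ‖x‖ ∧ ‖x‖ < 2 ∧ (18 / 25 : ℝ) * (‖x‖ * ‖ω‖) < ⟪x, ω⟫ := Iff.rfl

/-- Annular sectors are open. [folklore] -/
theorem isOpen_annSector (ω : E3) : IsOpen (annSector ω) :=
  (isOpen_lt continuous_const continuous_norm).inter ((isOpen_lt continuous_norm continuous_const).inter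
    (isOpen_lt (continuous_const.mul (continuous_norm.mul continuous_const)) (continuous_id.inner continuous_const)))

/-- Annular sectors lie in the annulus `A₁ = {1 < |x| < 2}`. [folklore] -/
theorem annSector_subset (ω : E3) : annSector ω ⊆ {x : E3 | 1 < ‖x‖ ∧ ‖x‖ < 2} :=
  fun _ hx ↦ ⟨hx.1, hx.2.1⟩

/-- Membership in terms of the unit direction `ω̂ = ω/|ω|`. [folklore] -/
theorem mem_annSector_iff_unit {ω x : E3} (hω : ω ≠ 0) :
    x ∈ annSector ω ↔ 1 < ‖x‖ ∧ ‖x‖ < 2 ∧ (18 / 25 : ℝ) * ‖x‖ < ⟪x, ‖ω‖⁻¹ • ω⟫ := by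
  have hn : 0 < ‖ω‖ := norm_pos_iff.2 hω
  rw [mem_annSector, real_inner_smul_right]
  constructor
  · rintro ⟨h1, h2, h3⟩
    refine ⟨h1, h2, ?_⟩
    rw [← div_eq_inv_mul, lt_div_iff₀ hn]
    linarith
  · rintro ⟨h1, h2, h3⟩
    refine ⟨h1, h2, ?_⟩
    rw [← div_eq_inv_mul, lt_div_iff₀ hn] at h3
    linarith

/-- **Annular sectors are star-shaped with respect to a ball**: `annSector ω` is star-shaped with respect to
every point of the ball of radius `1/20` about `(3/2) ω/|ω|`. [cite: MaoOhTao2023, Lemma 2.2 (proof)] -/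
theorem starConvex_annSector {ω : E3} (hω : ω ≠ 0) {b : E3}
    (hb : b ∈ ball (((3 / 2 : ℝ) * ‖ω‖⁻¹) • ω) (1 / 20)) : StarConvex ℝ b (annSector ω) := by
  have hn : 0 < ‖ω‖ := norm_pos_iff.2 hω
  set u : E3 := ‖ω‖⁻¹ • ω with hu
  have hu1 : ‖u‖ = 1 := by rw [hu, norm_smul, norm_inv, norm_norm, inv_mul_cancel₀ hn.ne']
  have hc : ((3 / 2 : ℝ) * ‖ω‖⁻¹) • ω = (3 / 2 : ℝ) • u := by rw [hu, smul_smul]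
  rw [hc, mem_ball, dist_eq_norm] at hb
  -- estimates for `b`
  have hbu : 29 / 20 ≤ ⟪b, u⟫ := by
    have e : ⟪b, u⟫ = 3 / 2 + ⟪b - (3 / 2 : ℝ) • u, u⟫ := by
      rw [inner_sub_left, real_inner_smul_left, real_inner_self_eq_norm_sq, hu1]; ring
    have h := abs_real_inner_le_norm (b - (3 / 2 : ℝ) • u) u
    rw [hu1, mul_one] at h
    have := (abs_le.1 h).1
    linarith
  have hbn : ‖b‖ ≤ 31 / 20 := by
    have h := norm_le_norm_sub_add b ((3 / 2 : ℝ) • u)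
    have : ‖(3 / 2 : ℝ) • u‖ = 3 / 2 := by rw [norm_smul, hu1, mul_one, Real.norm_eq_abs]; norm_num
    linarith
  intro x hx a t ha ht hat
  rw [mem_annSector_iff_unit hω] at hx ⊢
  obtain ⟨hx1, hx2, hxu⟩ := hx
  have hx0 : 0 < ‖x‖ := by linarith
  -- `b·x > (103/100)|x|`
  have hbx : (103 / 100 : ℝ) * ‖x‖ < ⟪b, x⟫ := by
    have e : ⟪b, x⟫ = (3 / 2 : ℝ) * ⟪x, u⟫ + ⟪b - (3 / 2 : ℝ) • u, x⟫ := by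
      rw [inner_sub_left, real_inner_smul_left, real_inner_comm u x]; ring
    have h := abs_real_inner_le_norm (b - (3 / 2 : ℝ) • u) x
    have h' := (abs_le.1 h).1
    have : ‖b - (3 / 2 : ℝ) • u‖ * ‖x‖ ≤ (1 / 20 : ℝ) * ‖x‖ := mul_le_mul_of_nonneg_right hb.le hx0.le
    nlinarith
  set y : E3 := a • b + t • x with hy
  -- positivity of the "gain" along the segment
  have hgain : ∀ {p q : ℝ}, 0 < p → 0 < q → 0 < p * a + q * t := by
    intro p q hp hq
    rcases eq_or_lt_of_le ht with h0 | h0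
    · rw [← h0] at hat ⊢; rw [add_zero] at hat; rw [hat]; simpa using hp
    · nlinarith
  refine ⟨?_, ?_, ?_⟩
  · -- `|y| > 1` from `y·x > |x|`
    have hyx : ⟪y, x⟫ = a * ⟪b, x⟫ + t * ‖x‖ ^ 2 := by
      rw [hy, inner_add_left, real_inner_smul_left, real_inner_smul_left, real_inner_self_eq_norm_sq]
    have hcs := real_inner_le_norm y x
    have hlow : ‖x‖ < ⟪y, x⟫ := by
      rw [hyx]
      have hg := hgain (p := 3 / 100) (q := ‖x‖ - 1) (by norm_num) (by linarith)
      nlinarith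
    by_contra hcon
    push Not at hcon
    nlinarith
  · -- `|y| < 2`
    calc ‖y‖ ≤ ‖a • b‖ + ‖t • x‖ := norm_add_le _ _
      _ = a * ‖b‖ + t * ‖x‖ := by
          rw [norm_smul, norm_smul, Real.norm_eq_abs, Real.norm_eq_abs, abs_of_nonneg ha, abs_of_nonneg ht]
      _ < 2 := by
          have hg := hgain (p := 9 / 20) (q := 2 - ‖x‖) (by norm_num) (by linarith)
          nlinarith
  · -- the cone condition is convex
    have hyu : ⟪y, u⟫ = a * ⟪b, u⟫ + t * ⟪x, u⟫ := by
      rw [hy, inner_add_left, real_inner_smul_left, real_inner_smul_left]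
    have hyn : ‖y‖ ≤ a * ‖b‖ + t * ‖x‖ := by
      calc ‖y‖ ≤ ‖a • b‖ + ‖t • x‖ := norm_add_le _ _
        _ = a * ‖b‖ + t * ‖x‖ := by
            rw [norm_smul, norm_smul, Real.norm_eq_abs, Real.norm_eq_abs, abs_of_nonneg ha, abs_of_nonneg ht]
    rw [hyu]
    have hg := hgain (p := 29 / 20 - 18 / 25 * (31 / 20)) (q := ⟪x, u⟫ - 18 / 25 * ‖x‖) (by norm_num)
      (by linarith)
    nlinarith [mul_le_mul_of_nonneg_left hbn ha]

/-! ### The fourteen directions and the witness points -/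

/-- Signs `±1` from a Boolean vector. [folklore] -/
def sgn (s : Fin 3 → Bool) (j : Fin 3) : ℝ := if s j then 1 else -1

/-- `sgn² = 1`. [folklore] -/
theorem sgn_sq (s : Fin 3 → Bool) (j : Fin 3) : sgn s j ^ 2 = 1 := by
  unfold sgn; split <;> norm_num

/-- `sgn · sgn = 1`. [folklore] -/
theorem sgn_mul_self (s : Fin 3 → Bool) (j : Fin 3) : sgn s j * sgn s j = 1 := by
  unfold sgn; split <;> norm_num

/-- `xⱼ · sgn = |xⱼ|` for the sign vector of `x`. [folklore] -/
theorem mul_sgn_decide (x : E3) (j : Fin 3) : x j * sgn (fun k ↦ decide (0 ≤ x k)) j = |x j| := by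
  unfold sgn
  by_cases h : 0 ≤ x j
  · simp [h, abs_of_nonneg h]
  · simp [h, abs_of_neg (not_le.1 h)]

/-- The corner direction `(±1, ±1, ±1)`. [folklore] -/
def corner (s : Fin 3 → Bool) : E3 := WithLp.toLp 2 fun j ↦ sgn s j

/-- The signed axis direction `±eᵢ`. [folklore] -/
def axis (i : Fin 3) (pos : Bool) : E3 := WithLp.toLp 2 fun j ↦ if j = i then (if pos then 1 else -1) else 0

/-- The witness point with `i`-th coordinate `±6/5` and the other two `±7/20` (signs `s`): it lies in the sectors about
`±eᵢ` (sign `s i`) and about the corner `s`. [folklore] -/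
def wpt (i : Fin 3) (s : Fin 3 → Bool) : E3 :=
  WithLp.toLp 2 fun j ↦ if j = i then (6 / 5 : ℝ) * sgn s j else (7 / 20 : ℝ) * sgn s j

/-- `|corner s|² = 3`. [folklore] -/
theorem norm_corner_sq (s : Fin 3 → Bool) : ‖corner s‖ ^ 2 = 3 := by
  rw [norm_sq_fin3]; simp [corner, sgn_sq]; norm_num

/-- `|axis i pos| = 1`. [folklore] -/
theorem norm_axis (i : Fin 3) (pos : Bool) : ‖axis i pos‖ = 1 := by
  have h : ‖axis i pos‖ ^ 2 = 1 := by
    rw [norm_sq_fin3]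
    fin_cases i <;> cases pos <;> simp [axis]
  nlinarith [norm_nonneg (axis i pos)]

/-- `|wpt i s|² = 337/200`. [folklore] -/
theorem norm_wpt_sq (i : Fin 3) (s : Fin 3 → Bool) : ‖wpt i s‖ ^ 2 = 337 / 200 := by
  rw [norm_sq_fin3]
  fin_cases i <;> simp [wpt, mul_pow, sgn_sq] <;> norm_num

/-- `wpt i s · corner s = 19/10`. [folklore] -/
theorem inner_wpt_corner (i : Fin 3) (s : Fin 3 → Bool) : ⟪wpt i s, corner s⟫ = 19 / 10 := by
  rw [inner_fin3]
  fin_cases i <;> simp [wpt, corner, mul_assoc, sgn_mul_self] <;> norm_num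

/-- `axis i (s i)` has `i`-th entry `sgn s i`. [folklore] -/
theorem axis_apply (i j : Fin 3) (s : Fin 3 → Bool) : axis i (s i) j = if j = i then sgn s j else 0 := by
  by_cases h : j = i
  · subst h; simp [axis, sgn]
  · simp [axis, h]

/-- `wpt i s · (±eᵢ) = 6/5`. [folklore] -/
theorem inner_wpt_axis (i : Fin 3) (s : Fin 3 → Bool) : ⟪wpt i s, axis i (s i)⟫ = 6 / 5 := by
  rw [inner_fin3, axis_apply, axis_apply, axis_apply]
  fin_cases i <;> simp [wpt, mul_assoc, sgn_mul_self]

/-- The witness point lies in the sector about the corner. [folklore] -/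
theorem wpt_mem_annSector_corner (i : Fin 3) (s : Fin 3 → Bool) : wpt i s ∈ annSector (corner s) := by
  have hn2 := norm_wpt_sq i s
  have hn0 := norm_nonneg (wpt i s)
  have hc2 := norm_corner_sq s
  have hc0 := norm_nonneg (corner s)
  refine ⟨by nlinarith, by nlinarith, ?_⟩
  rw [inner_wpt_corner]
  -- `(18/25)|p||c| < 19/10` since `(18/25)²·(337/200)·3 < (19/10)²`
  have h : ((18 / 25 : ℝ) * (‖wpt i s‖ * ‖corner s‖)) ^ 2 < (19 / 10 : ℝ) ^ 2 := by
    rw [mul_pow, mul_pow, hn2, hc2]; norm_num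
  exact lt_of_pow_lt_pow_left₀ 2 (by norm_num) h

/-- The witness point lies in the sector about the axis. [folklore] -/
theorem wpt_mem_annSector_axis (i : Fin 3) (s : Fin 3 → Bool) : wpt i s ∈ annSector (axis i (s i)) := by
  have hn2 := norm_wpt_sq i s
  have hn0 := norm_nonneg (wpt i s)
  refine ⟨by nlinarith, by nlinarith, ?_⟩
  rw [inner_wpt_axis, norm_axis, mul_one]
  have h : ((18 / 25 : ℝ) * ‖wpt i s‖) ^ 2 < (6 / 5 : ℝ) ^ 2 := by
    rw [mul_pow, hn2]; norm_num
  exact lt_of_pow_lt_pow_left₀ 2 (by norm_num) h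

/-! ### The fourteen sectors cover the annulus -/

/-- **Covering**: every point of `A₁` lies in the sector about a corner `(±1, ±1, ±1)` or about a signed axis `±eᵢ`.
[cite: MaoOhTao2023, Lemma 2.2 (proof)] -/
theorem exists_mem_annSector (x : E3) (hx1 : 1 < ‖x‖) (hx2 : ‖x‖ < 2) :
    (∃ s, x ∈ annSector (corner s)) ∨ ∃ (i : Fin 3) (s : Fin 3 → Bool), x ∈ annSector (axis i (s i)) := by
  set s : Fin 3 → Bool := fun k ↦ decide (0 ≤ x k) with hs
  have hx0 : 0 < ‖x‖ := by linarith
  have hxc : ⟪x, corner s⟫ = |x 0| + |x 1| + |x 2| := by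
    rw [inner_fin3]
    simp only [corner, PiLp.toLp_apply]
    rw [mul_sgn_decide, mul_sgn_decide, mul_sgn_decide]
  have hcn : ‖corner s‖ = Real.sqrt 3 := by
    rw [← Real.sqrt_sq (norm_nonneg (corner s)), norm_corner_sq]
  by_cases hcase : (18 / 25 : ℝ) * (‖x‖ * Real.sqrt 3) < |x 0| + |x 1| + |x 2|
  · exact Or.inl ⟨s, hx1, hx2, by rwa [hxc, hcn]⟩
  · right
    push Not at hcase
    -- some coordinate is large: otherwise `|x|² ≤ (18/25)|x| Σ|xᵢ| ≤ (18/25)²√3 |x|² < |x|²`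
    have h3 : Real.sqrt 3 < 48 / 25 := by
      rw [Real.sqrt_lt' (by norm_num)]; norm_num
    have hsq : ‖x‖ ^ 2 = |x 0| ^ 2 + |x 1| ^ 2 + |x 2| ^ 2 := by rw [norm_sq_fin3, sq_abs, sq_abs, sq_abs]
    have hex : ∃ i : Fin 3, (18 / 25 : ℝ) * ‖x‖ < |x i| := by
      by_contra hcon
      push Not at hcon
      have h0 := hcon 0; have h1 := hcon 1; have h2 := hcon 2
      have hb : |x 0| ^ 2 + |x 1| ^ 2 + |x 2| ^ 2 ≤ (18 / 25 : ℝ) * ‖x‖ * (|x 0| + |x 1| + |x 2|) := by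
        nlinarith [abs_nonneg (x 0), abs_nonneg (x 1), abs_nonneg (x 2)]
      have hs3 : 0 ≤ Real.sqrt 3 := Real.sqrt_nonneg 3
      nlinarith
    obtain ⟨i, hi⟩ := hex
    refine ⟨i, s, hx1, hx2, ?_⟩
    rw [norm_axis, mul_one, inner_fin3, axis_apply, axis_apply, axis_apply]
    fin_cases i
    · simpa [mul_sgn_decide, hs] using hi
    · simpa [mul_sgn_decide, hs] using hi
    · simpa [mul_sgn_decide, hs] using hi


/-! ### An enumeration in which each sector meets an earlier one -/

/-- The fourteen directions, in gluing order: `+e₀`; the four corners with first sign `+`; `+e₁, +e₂, −e₁, −e₂`; the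
four corners with first sign `−`; `−e₀` (and `−e₀` from index `13` on). [folklore] -/
def dirList : List E3 :=
  [axis 0 true, corner ![true, true, true], corner ![true, true, false], corner ![true, false, true],
    corner ![true, false, false], axis 1 true, axis 2 true, axis 1 false, axis 2 false,
    corner ![false, true, true], corner ![false, true, false], corner ![false, false, true],
    corner ![false, false, false], axis 0 false]

/-- The gluing sequence of directions (constant `−e₀` from index `13` on). [folklore] -/
def dirSeq (n : ℕ) : E3 := dirList.getD n (axis 0 false)

/-- From index `13` on the sequence is `−e₀`. [folklore] -/
theorem dirSeq_of_le {n : ℕ} (hn : 13 ≤ n) : dirSeq n = axis 0 false := by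
  rcases Nat.lt_or_ge n 14 with h | h
  · obtain rfl : n = 13 := by omega
    rfl
  · show dirList.getD n (axis 0 false) = axis 0 false
    apply List.getD_eq_default
    have hl : dirList.length = 14 := rfl
    omega

/-- Every corner direction occurs among the first fourteen. [folklore] -/
theorem exists_dirSeq_eq_corner (s : Fin 3 → Bool) : ∃ j ≤ 13, dirSeq j = corner s := by
  have hs : ∀ a b c, s 0 = a → s 1 = b → s 2 = c → s = ![a, b, c] := by
    intro a b c h0 h1 h2; funext j; fin_cases j <;> simp [h0, h1, h2]
  match h0 : s 0, h1 : s 1, h2 : s 2 with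
  | true, true, true => exact ⟨1, by norm_num, by rw [hs _ _ _ h0 h1 h2]; rfl⟩
  | true, true, false => exact ⟨2, by norm_num, by rw [hs _ _ _ h0 h1 h2]; rfl⟩
  | true, false, true => exact ⟨3, by norm_num, by rw [hs _ _ _ h0 h1 h2]; rfl⟩
  | true, false, false => exact ⟨4, by norm_num, by rw [hs _ _ _ h0 h1 h2]; rfl⟩
  | false, true, true => exact ⟨9, by norm_num, by rw [hs _ _ _ h0 h1 h2]; rfl⟩
  | false, true, false => exact ⟨10, by norm_num, by rw [hs _ _ _ h0 h1 h2]; rfl⟩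
  | false, false, true => exact ⟨11, by norm_num, by rw [hs _ _ _ h0 h1 h2]; rfl⟩
  | false, false, false => exact ⟨12, by norm_num, by rw [hs _ _ _ h0 h1 h2]; rfl⟩

/-- Every signed axis direction occurs among the first fourteen. [folklore] -/
theorem exists_dirSeq_eq_axis (i : Fin 3) (b : Bool) : ∃ j ≤ 13, dirSeq j = axis i b := by
  fin_cases i <;> cases b
  · exact ⟨13, le_rfl, rfl⟩
  · exact ⟨0, by norm_num, rfl⟩
  · exact ⟨7, by norm_num, rfl⟩
  · exact ⟨5, by norm_num, rfl⟩
  · exact ⟨8, by norm_num, rfl⟩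
  · exact ⟨6, by norm_num, rfl⟩

/-- **The chain condition**: each sector of the sequence meets the union of the earlier ones, at an explicit
witness point. [folklore] -/
theorem dirSeq_chain (k : ℕ) : ∃ p, p ∈ annSector (dirSeq (k + 1)) ∧ p ∈ ⋃ i ≤ k, annSector (dirSeq i) := by
  have mk : ∀ {p : E3} (j : ℕ), j ≤ k → p ∈ annSector (dirSeq j) → p ∈ ⋃ i ≤ k, annSector (dirSeq i) :=
    fun j hj hp ↦ mem_iUnion₂.2 ⟨j, hj, hp⟩
  rcases Nat.lt_or_ge k 13 with hk | hk
  · interval_cases k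
    · exact ⟨_, wpt_mem_annSector_corner 0 ![true, true, true], mk 0 le_rfl
        (wpt_mem_annSector_axis 0 ![true, true, true])⟩
    · exact ⟨_, wpt_mem_annSector_corner 0 ![true, true, false], mk 0 (by norm_num)
        (wpt_mem_annSector_axis 0 ![true, true, false])⟩
    · exact ⟨_, wpt_mem_annSector_corner 0 ![true, false, true], mk 0 (by norm_num)
        (wpt_mem_annSector_axis 0 ![true, false, true])⟩
    · exact ⟨_, wpt_mem_annSector_corner 0 ![true, false, false], mk 0 (by norm_num)
        (wpt_mem_annSector_axis 0 ![true, false, false])⟩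
    · exact ⟨_, wpt_mem_annSector_axis 1 ![true, true, true], mk 1 (by norm_num)
        (wpt_mem_annSector_corner 1 ![true, true, true])⟩
    · exact ⟨_, wpt_mem_annSector_axis 2 ![true, true, true], mk 1 (by norm_num)
        (wpt_mem_annSector_corner 2 ![true, true, true])⟩
    · exact ⟨_, wpt_mem_annSector_axis 1 ![true, false, true], mk 3 (by norm_num)
        (wpt_mem_annSector_corner 1 ![true, false, true])⟩
    · exact ⟨_, wpt_mem_annSector_axis 2 ![true, true, false], mk 2 (by norm_num)
        (wpt_mem_annSector_corner 2 ![true, true, false])⟩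
    · exact ⟨_, wpt_mem_annSector_corner 1 ![false, true, true], mk 5 (by norm_num)
        (wpt_mem_annSector_axis 1 ![false, true, true])⟩
    · exact ⟨_, wpt_mem_annSector_corner 1 ![false, true, false], mk 5 (by norm_num)
        (wpt_mem_annSector_axis 1 ![false, true, false])⟩
    · exact ⟨_, wpt_mem_annSector_corner 2 ![false, false, true], mk 6 (by norm_num)
        (wpt_mem_annSector_axis 2 ![false, false, true])⟩
    · exact ⟨_, wpt_mem_annSector_corner 1 ![false, false, false], mk 7 (by norm_num)
        (wpt_mem_annSector_axis 1 ![false, false, false])⟩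
    · exact ⟨_, wpt_mem_annSector_axis 0 ![false, true, true], mk 9 (by norm_num)
        (wpt_mem_annSector_corner 0 ![false, true, true])⟩
  · refine ⟨wpt 0 ![false, true, true], ?_, mk 13 hk ?_⟩
    · rw [dirSeq_of_le (by omega)]
      exact wpt_mem_annSector_axis 0 ![false, true, true]
    · exact wpt_mem_annSector_axis 0 ![false, true, true]

/-- **The first fourteen sectors cover exactly the annulus `A₁`.** [cite: MaoOhTao2023, Lemma 2.2 (proof)] -/
theorem biUnion_annSector_dirSeq_eq : (⋃ i ≤ 13, annSector (dirSeq i)) = {x : E3 | 1 < ‖x‖ ∧ ‖x‖ < 2} := by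
  refine Subset.antisymm (iUnion₂_subset fun i _ ↦ annSector_subset _) fun x hx ↦ ?_
  rcases exists_mem_annSector x hx.1 hx.2 with ⟨s, hs⟩ | ⟨i, s, hs⟩
  · obtain ⟨j, hj, hjs⟩ := exists_dirSeq_eq_corner s
    exact mem_iUnion₂.2 ⟨j, hj, by rwa [hjs]⟩
  · obtain ⟨j, hj, hjs⟩ := exists_dirSeq_eq_axis i (s i)
    exact mem_iUnion₂.2 ⟨j, hj, by rwa [hjs]⟩

/-- Every term of the sequence is a signed axis or a corner direction. [folklore] -/
theorem dirSeq_eq_axis_or_corner (n : ℕ) : (∃ i b, dirSeq n = axis i b) ∨ ∃ s, dirSeq n = corner s := by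
  rcases Nat.lt_or_ge n 13 with hn | hn
  · interval_cases n
    · exact Or.inl ⟨0, true, rfl⟩
    · exact Or.inr ⟨![true, true, true], rfl⟩
    · exact Or.inr ⟨![true, true, false], rfl⟩
    · exact Or.inr ⟨![true, false, true], rfl⟩
    · exact Or.inr ⟨![true, false, false], rfl⟩
    · exact Or.inl ⟨1, true, rfl⟩
    · exact Or.inl ⟨2, true, rfl⟩
    · exact Or.inl ⟨1, false, rfl⟩
    · exact Or.inl ⟨2, false, rfl⟩
    · exact Or.inr ⟨![false, true, true], rfl⟩
    · exact Or.inr ⟨![false, true, false], rfl⟩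
    · exact Or.inr ⟨![false, false, true], rfl⟩
    · exact Or.inr ⟨![false, false, false], rfl⟩
  · exact Or.inl ⟨0, false, dirSeq_of_le hn⟩

/-- The sequence consists of non-zero vectors. [folklore] -/
theorem dirSeq_ne_zero (n : ℕ) : dirSeq n ≠ 0 := by
  rcases dirSeq_eq_axis_or_corner n with ⟨i, b, h⟩ | ⟨s, h⟩
  · rw [h]
    intro h0
    have := norm_axis i b
    rw [h0, norm_zero] at this
    exact zero_ne_one this
  · rw [h]
    intro h0
    have := norm_corner_sq s
    rw [h0, norm_zero] at this
    norm_num at this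

/-- **Summary (the geometric input of the recursion in Lemma 2.2)**: the annulus `A₁ = {1 < |x| < 2}` is the union of
the fourteen open sets `annSector (dirSeq i)`, `i ≤ 13`, each star-shaped with respect to every point of a ball of
radius `1/20`, and each meeting the union of the previous ones. [cite: MaoOhTao2023, Lemma 2.2 (proof)] -/
theorem annulus_cover_summary :
    (⋃ i ≤ 13, annSector (dirSeq i)) = {x : E3 | 1 < ‖x‖ ∧ ‖x‖ < 2} ∧
      (∀ n, IsOpen (annSector (dirSeq n))) ∧
      (∀ n, ∀ b ∈ ball (((3 / 2 : ℝ) * ‖dirSeq n‖⁻¹) • dirSeq n) (1 / 20), StarConvex ℝ b (annSector (dirSeq n))) ∧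
      ∀ k, ∃ p, p ∈ annSector (dirSeq (k + 1)) ∧ p ∈ ⋃ i ≤ k, annSector (dirSeq i) :=
  ⟨biUnion_annSector_dirSeq_eq, fun _ ↦ isOpen_annSector _,
    fun n _ hb ↦ starConvex_annSector (dirSeq_ne_zero n) hb, dirSeq_chain⟩

end MaoOhTao

end Literature.Geometry.Lorentzian

end
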